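import Literature.MathematicalPhysics.QuantumFieldTheory.Balaban1983to89.B9Thm313WholeDvFromDds

/-!
# `Balaban1983to89.B9Thm313WholeDvFromDdsAnyNorm` — [B9] Theorem 3.3 (3.45) p. 398 with (3.3) p. 390: A WORD ENDING IN D_U FROM ITS MEMBERS ENDING IN ∇\*_{U,μ} AND THE LETTER
# J_μ, BETWEEN ARBITRARY BLOCK NORMS (the Hölder-SOURCE currency of `hdgDvd13 ∕ hpdgDvd13`: source class on the W-sector, any intermediate bond input class, any target,
# optionally a target-block weight such as `(Lʲη)^{−β}`)

T. Bałaban, *Propagators for lattice gauge theories in a background field*, Commun. Math. Phys. **99** (1985) 389–434 [`Balaban1985BackgroundPropagators`, "B9"]; [4] = T. Bałaban,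
*Propagators and renormalization transformations for lattice gauge theories. II*, Commun. Math. Phys. **96** (1984) 223–250 [`Balaban1984PropagatorsII`].
statement-level skeleton of published theorems with citation tags; proofs where landed; nothing here is a claim about the Yang–Mills mass gap

THE PRINTED LOCUS.  (3.3) p. 390 (D_U = Σ_μ ∇\*_{U,μ}∘J_μ, def-Y `DvcoKH_eq_sum`); (3.45) p. 398 (*"|(∇_UG′(U)∇\*_Uλ)(x)| ≦ B′₀(ε)e^{−δ₀d(y,y′)}(‖λ‖^{ξ′}_ε + |λ|)"*, the
Hölder-SOURCE members, and their probe form with the factor `(Lʲη)^{−β}`); [4] (2.52)–(2.56) pp. 232–233 (compositions and sums of exponential block majorants).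

WHY THIS FILE (cell `pub-ymgap`, node N06 [B9], rows 20–21; seat `pub-ymgap-dag-n06-c` g21, `LOCATED22-ADOPTION-MEMO-g21.md` §3.3 (b), road confirmed by dag-n06-l g32).
dag-n06-l g17's `B9Thm313WholeDvFromDds` types "letter∘D_U from letters∘∇\*_{U,μ} + J_μ" in the SUP (`cNorm`), PROBE (`cNormR`) and block-L² currencies; the certificate's
last two smooth-source letters `hdgDvd13 : HasMaj (bHW U ε) (ofBlocks blk) (∇_{U,ν} ∘ G₀ ∘ D_U)` and `hpdgDvd13 : HasMaj (bHW U (β+ε)) (ofBlocks blkPX) ((Φ^X_β ∘ ∇_{U,ν}) ∘ G₀ ∘ D_U)`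
(kernel `B·(Lʲη)^{−β}·e^{−δd}`) are the same algebra in the INPUT-CLASS currency: source = a Hölder class on the W-sector, members = the G₀ layer's (3.45) entries
`Thm33G0Dir.h45m ∕ .h45mP`-type at a bond input class, the letter = J_μ between the two classes (`B9GradLetterTransportedInputClasses`).  THIS FILE states it ONCE for arbitrary
block norms: §1 `hasMaj_comp_exp_mirror_tw` — composition with ONE row sum when the left kernel carries a target-block factor `f a ≥ 0` (it rides along); §2 ★★
`word_dv_of_members` (plain kernels) and ★★ `word_dv_of_members_tw` (target-weighted kernels): `HasMaj b₁ b₃ (A ∘ D_U) (B·f·e^{−ρd})` from `∀ μ, HasMaj b₂ b₃ (A ∘ ∇\*_{U,μ}) (Bᵢ·f·e^{−δ₁d})`,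
`∀ μ, HasMaj b₁ b₂ (J μ) (C_J e^{−δ_Jd})`, `D_U = Σ_μ ∇\*_{U,μ} ∘ J μ`, for `0 ≤ ρ ≤ δ₁`, `ρ + σ ≤ δ_J`, `B ≥ |P|·κ₂·Bᵢ·C_J·c`.

HONEST SCOPE.  Majorant algebra over landed modules; the members and the letter are HYPOTHESES; nothing of print's estimates asserted; COUNT-NEUTRAL; N06 NOT discharged; one
finite lattice at a time; nothing continuum, nothing about the mass gap.  A NEW file; 0 `def`, no `sorry`, no `axiom`, no `instance`, no `notation`.
-/

namespace Literature.MathematicalPhysics.QuantumFieldTheory.Balaban1983to89.B9Thm313WholeDvFromDdsAnyNorm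

open Literature.MathematicalPhysics.QuantumFieldTheory.Balaban1983to89
open Finset B6RandomWalk B6RandomWalkHom B9Thm34Ext B11SectG B9SectDSup B9SectDL2Decay B9Thm37Glue B9Thm312Whole
open B9Thm312WholeClasses B9RWSums343to347Whole B9PerturbationMajorantAlgebra B9Thm313WholeDvFromDds

noncomputable section

variable {g : B9.Geometry} {X W P : Type} [Fintype P] [Fintype g.Site]
variable {R₀ : ℝ} {H₀ : Prop}

/-! ## §1 Composition with one row sum, the left kernel carrying a target-block factor -/

/-- **COMPOSITION, MIRRORED MARGINS, TARGET-WEIGHTED LEFT KERNEL**: `T₁` with majorant `f(a)·a₁e^{−ρ₁d}` (`f ≥ 0` a function of the TARGET block only, `ρ₁ ≥ ρ`) after `T₂` with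
`a₂e^{−ρ₂d}` (`ρ₂ ≥ ρ + σ`): `T₁∘T₂` has `f(a)·κ₂a₁a₂c·e^{−ρd}` — `B9SectDSup.hasMaj_comp_exp_mirror` with the factor `f(a)` riding along the row sum.
[cite: Balaban1984PropagatorsII, (2.52)–(2.56) pp.232–233; Balaban1985BackgroundPropagators, (3.45) p.398 (the factor (Lʲη)^{−β})] -/
theorem hasMaj_comp_exp_mirror_tw {G : B6.Geometry} {F₁ F₂ F₃ : Type} [AddCommGroup F₁] [Module ℝ F₁] [AddCommGroup F₂] [Module ℝ F₂]
    [AddCommGroup F₃] [Module ℝ F₃] {b₁ : BlockNorm G F₁} {b₂ : BlockNorm G F₂} {b₃ : BlockNorm G F₃}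
    {T₁ : F₂ →ₗ[ℝ] F₃} {T₂ : F₁ →ₗ[ℝ] F₂} {a₁ a₂ ρ₁ ρ₂ ρ σ c : ℝ} {f : G.Site → ℝ} (hsym : DistSymm G)
    (htri : Triangle254 G) (hd : ∀ a b : G.Site, 0 ≤ G.dist a b) (hrow : RowSum G σ c)
    (hf : ∀ a, 0 ≤ f a) (ha₁ : 0 ≤ a₁) (ha₂ : 0 ≤ a₂) (hρ : 0 ≤ ρ) (hρ₁ : ρ ≤ ρ₁) (hρ₂ : ρ + σ ≤ ρ₂)
    (h₁ : HasMaj b₂ b₃ T₁ (fun a b => f a * a₁ * Real.exp (-(ρ₁ * G.dist a b))))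
    (h₂ : HasMaj b₁ b₂ T₂ (fun a b => a₂ * Real.exp (-(ρ₂ * G.dist a b)))) :
    HasMaj b₁ b₃ (T₁ ∘ₗ T₂) (fun a b => f a * (b₂.κ * a₁ * a₂ * c) * Real.exp (-(ρ * G.dist a b))) := by
  refine (hasMaj_comp h₁ h₂ fun a b => mul_nonneg (mul_nonneg (hf a) ha₁) (Real.exp_nonneg _)).mono fun a b => ?_
  have hconv := conv_exp_le_mirror hsym htri hd hrow hρ hρ₁ hρ₂ a b
  calc ∑ y'' : G.Site, f a * a₁ * Real.exp (-(ρ₁ * G.dist a y'')) * (b₂.κ * (a₂ * Real.exp (-(ρ₂ * G.dist y'' b))))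
      = f a * (b₂.κ * a₁ * a₂) * ∑ y'' : G.Site, Real.exp (-(ρ₁ * G.dist a y'')) * Real.exp (-(ρ₂ * G.dist y'' b)) := by
        rw [Finset.mul_sum]; exact Finset.sum_congr rfl fun y'' _ => by ring
    _ ≤ f a * (b₂.κ * a₁ * a₂) * (c * Real.exp (-(ρ * G.dist a b))) :=
        mul_le_mul_of_nonneg_left hconv (mul_nonneg (hf a) (mul_nonneg (mul_nonneg b₂.κ_nonneg ha₁) ha₂))
    _ = _ := by ring

/-! ## §2 A word ending in D_U from its members ending in ∇\*_{U,μ} and the letter J_μ, any block norms -/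

omit [Fintype P] in
/-- ★★ **`A ∘ D_U` FROM `A ∘ ∇\*_{U,μ}` AND `J_μ`, ANY NORMS, PLAIN KERNELS**: with `D_U = Σ_μ ∇\*_{U,μ} ∘ J μ`, members `HasMaj b₂ b₃ (A ∘ ∇\*_{U,μ}) (Bᵢe^{−δ₁d})`
(e.g. the G₀ layer's (3.45) entries at a bond input class) and the letter `HasMaj b₁ b₂ (J μ) (C_Je^{−δ_Jd})` (e.g. between the W-sector and bond input classes):
`HasMaj b₁ b₃ (A ∘ D_U) (B e^{−ρd})` for `0 ≤ ρ ≤ δ₁`, `ρ + σ ≤ δ_J`, `B ≥ |P|·κ₂·Bᵢ·C_J·c` — dag-n06-l's `gD1_of_e2d ∕ dGDvd_l2_of_l4m` pattern, norm-generic.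
[cite: Balaban1985BackgroundPropagators, Thm 3.3 (3.45) p.398 + (3.3) p.390 + (3.133) p.422; Balaban1984PropagatorsII, (2.52)–(2.56) pp.232–233] -/
theorem word_dv_of_members (hG : GeoOK g) {σ c : ℝ} (hrow : RowSum (toB6 g R₀ H₀) σ c) [Fintype P]
    {V : Type} {b₁ : BlockNorm (toB6 g R₀ H₀) (W → ℝ)} {b₂ : BlockNorm (toB6 g R₀ H₀) (X → ℝ)} {b₃ : BlockNorm (toB6 g R₀ H₀) (V → ℝ)}
    {A : (X → ℝ) →ₗ[ℝ] (V → ℝ)} {Dds : P → Module.End ℝ (X → ℝ)} {J : P → (W → ℝ) →ₗ[ℝ] (X → ℝ)} {Dv : (W → ℝ) →ₗ[ℝ] (X → ℝ)}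
    {Bi δ₁ CJ δJ ρ B : ℝ} (hBi : 0 ≤ Bi) (hCJ : 0 ≤ CJ) (hρ : 0 ≤ ρ) (hρ₁ : ρ ≤ δ₁) (hρJ : ρ + σ ≤ δJ)
    (hB : (Fintype.card P : ℝ) * (b₂.κ * Bi * CJ * c) ≤ B)
    (hDv : Dv = ∑ μ, Dds μ ∘ₗ J μ)
    (hA : ∀ μ, HasMaj b₂ b₃ (A ∘ₗ Dds μ) (fun (a b : g.Site) => Bi * Real.exp (-(δ₁ * g.dist a b))))
    (hJ : ∀ μ, HasMaj b₁ b₂ (J μ) (fun (a b : g.Site) => CJ * Real.exp (-(δJ * g.dist a b)))) :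
    HasMaj b₁ b₃ (A ∘ₗ Dv) (fun (a b : g.Site) => B * Real.exp (-(ρ * g.dist a b))) := by
  have htri : Triangle254 (toB6 g R₀ H₀) := fun a b c => hG.tri a b c
  have hsym : DistSymm (toB6 g R₀ H₀) := fun a b => hG.symm a b
  have h2 : ∀ μ ∈ (Finset.univ : Finset P), HasMaj b₁ b₃ ((A ∘ₗ Dds μ) ∘ₗ J μ) (fun (a b : g.Site) => b₂.κ * Bi * CJ * c * Real.exp (-(ρ * g.dist a b))) :=
    fun μ _ => (hasMaj_comp_exp_mirror hsym htri hG.dnn hrow hBi hCJ hρ hρ₁ hρJ (hA μ) (hJ μ)).mono fun a b => le_of_eq (by simp only [toB6_dist])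
  rw [comp_dv_eq_fsum hDv A]
  refine (hasMaj_fsum_const _ _ _ h2).mono fun a b => ?_
  rw [Finset.card_univ]
  calc (Fintype.card P : ℝ) * (b₂.κ * Bi * CJ * c * Real.exp (-(ρ * g.dist a b)))
      = (Fintype.card P : ℝ) * (b₂.κ * Bi * CJ * c) * Real.exp (-(ρ * g.dist a b)) := by ring
    _ ≤ B * Real.exp (-(ρ * g.dist a b)) := mul_le_mul_of_nonneg_right hB (Real.exp_nonneg _)

omit [Fintype P] in
/-- ★★ **THE SAME WITH A TARGET-BLOCK FACTOR** (`f ≥ 0` on the target block — e.g. `f a = (Lʲη)^{−β}` of the probe member (3.45)₂): members `HasMaj b₂ b₃ (A ∘ ∇\*_{U,μ})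
(f·Bᵢ·e^{−δ₁d})` and the letter `HasMaj b₁ b₂ (J μ) (C_Je^{−δ_Jd})` give `HasMaj b₁ b₃ (A ∘ D_U) (f·B·e^{−ρd})`, `B ≥ |P|·κ₂·Bᵢ·C_J·c`.
[cite: Balaban1985BackgroundPropagators, Thm 3.3 (3.45) p.398 + (3.3) p.390; Balaban1984PropagatorsII, (2.52)–(2.56) pp.232–233] -/
theorem word_dv_of_members_tw (hG : GeoOK g) {σ c : ℝ} (hrow : RowSum (toB6 g R₀ H₀) σ c) [Fintype P]
    {V : Type} {b₁ : BlockNorm (toB6 g R₀ H₀) (W → ℝ)} {b₂ : BlockNorm (toB6 g R₀ H₀) (X → ℝ)} {b₃ : BlockNorm (toB6 g R₀ H₀) (V → ℝ)}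
    {A : (X → ℝ) →ₗ[ℝ] (V → ℝ)} {Dds : P → Module.End ℝ (X → ℝ)} {J : P → (W → ℝ) →ₗ[ℝ] (X → ℝ)} {Dv : (W → ℝ) →ₗ[ℝ] (X → ℝ)}
    {f : g.Site → ℝ} {Bi δ₁ CJ δJ ρ B : ℝ} (hf : ∀ a, 0 ≤ f a) (hBi : 0 ≤ Bi) (hCJ : 0 ≤ CJ) (hρ : 0 ≤ ρ) (hρ₁ : ρ ≤ δ₁) (hρJ : ρ + σ ≤ δJ)
    (hB : (Fintype.card P : ℝ) * (b₂.κ * Bi * CJ * c) ≤ B)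
    (hDv : Dv = ∑ μ, Dds μ ∘ₗ J μ)
    (hA : ∀ μ, HasMaj b₂ b₃ (A ∘ₗ Dds μ) (fun (a b : g.Site) => f a * Bi * Real.exp (-(δ₁ * g.dist a b))))
    (hJ : ∀ μ, HasMaj b₁ b₂ (J μ) (fun (a b : g.Site) => CJ * Real.exp (-(δJ * g.dist a b)))) :
    HasMaj b₁ b₃ (A ∘ₗ Dv) (fun (a b : g.Site) => f a * B * Real.exp (-(ρ * g.dist a b))) := by
  have htri : Triangle254 (toB6 g R₀ H₀) := fun a b c => hG.tri a b c
  have hsym : DistSymm (toB6 g R₀ H₀) := fun a b => hG.symm a b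
  have h2 : ∀ μ ∈ (Finset.univ : Finset P), HasMaj b₁ b₃ ((A ∘ₗ Dds μ) ∘ₗ J μ)
      (fun (a b : g.Site) => f a * (b₂.κ * Bi * CJ * c) * Real.exp (-(ρ * g.dist a b))) :=
    fun μ _ => (hasMaj_comp_exp_mirror_tw (G := toB6 g R₀ H₀) hsym htri hG.dnn hrow hf hBi hCJ hρ hρ₁ hρJ (hA μ) (hJ μ)).mono
      fun a b => le_of_eq (by simp only [toB6_dist])
  rw [comp_dv_eq_fsum hDv A]
  refine (hasMaj_fsum_const _ _ _ h2).mono fun a b => ?_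
  rw [Finset.card_univ]
  calc (Fintype.card P : ℝ) * (f a * (b₂.κ * Bi * CJ * c) * Real.exp (-(ρ * g.dist a b)))
      = f a * ((Fintype.card P : ℝ) * (b₂.κ * Bi * CJ * c)) * Real.exp (-(ρ * g.dist a b)) := by ring
    _ ≤ f a * B * Real.exp (-(ρ * g.dist a b)) :=
        mul_le_mul_of_nonneg_right (mul_le_mul_of_nonneg_left hB (hf a)) (Real.exp_nonneg _)

end

end Literature.MathematicalPhysics.QuantumFieldTheory.Balaban1983to89.B9Thm313WholeDvFromDdsAnyNorm
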